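import Literature.NumberTheory.Automorphic.PadicGLnHeckeAlgebra
import HarnessLib

/-!
# The spherical Hecke algebra of `GL_2(ℚ_p)` is generated by `T(𝔭)`, `R(𝔭)`, `R(𝔭)⁻¹` (Bump Prop. 4.6.5), via the
# identification with `D(Λ², G_p²) = H_p² = k[t(p), (pE)_Λ, (pE)_Λ⁻¹]` (Andrianov–Zhuravlev Thm. 2.17 (2))

Topic `NumberTheory/Automorphic`; namespace `Literature.NumberTheory.Automorphic` (lane `lit-hodgefound`, Track 2
foundations; seat `lit-hodgefound-p11`, generation 40, row g40-#12).  THEOREMS ONLY: no definition, no named fact, no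
instance, no notation.

## Sources

Bump, *Automorphic Forms and Representations* (1997), §4.6 PROPOSITION 4.6.5 (PDF p. 495): «The spherical Hecke algebra
`ℋ_K` is generated by `T(𝔭)`, `R(𝔭)`, and `R(𝔭)⁻¹`» (for `GL(2, F)`, `F` non-archimedean local, `K = GL(2, 𝔬)`,
`T(𝔭)`, `R(𝔭)` the characteristic functions of `K diag(ϖ, 1) K`, `K ϖ K`; proof: the basis `K diag(ϖⁿ, ϖᵐ) K`,
`n ≥ m`, of PROP. 4.6.2 and the recursion (6.3)).  Andrianov–Zhuravlev Ch. 3 §2.2 THEOREM 2.17 (2) «the Hecke ring `H_pⁿ`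
is generated over `ℚ` by `π_1(p), …, π_{n-1}(p)` and `π_n(p)^{±1}`» (in the tree for `n = 2`:
`adjoin_doubleCosetOperator_glnAway_eq_adjoin_triple`, `range_map_glnAway_two`), transported to the `p`-adic side
along the comparison `ℋ(GL_2(F), GL_2(𝒪_F); k) ≃ₐ[k] D(Λ², G_p²) ⊗ k` of g40-#10/#11 (A–Z §1.3 Prop. 1.9).

## What is formalised (theorems only)

* `pScalar_mem_glnAway`, `pScalar_inv_mem_glnAway'`, `diagonalGL_one_prime_mem_glnAway'` — the three generators
  `diag(1, p)`, `pE`, `(pE)⁻¹` lie in `G_p` (subgroup form of g39 lemmas);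
* **`heckeAlgebra.adjoin_glnAway_two_doubleCosetOperator_triple_eq_top`** — the abstract Hecke ring
  `ℋ(G_p², Λ²; k) = D(Λ², G_p²) ⊗ k` is generated by the double cosets of `diag(1, p)`, `pE`, `(pE)⁻¹` (THM 2.17 (2));
* **`heckeAlgebra.adjoin_glInt_two_doubleCosetOperator_triple_eq_top`** — PROP. 4.6.5 for `F` as in g40-#10 (the prime
  `p` a uniformizer, `ℤ ↠ 𝓀[F]`), any commutative coefficient ring `k`: `ℋ(GL_2(F), GL_2(𝒪_F); k)` is generated by
  `K ι(diag(1,p)) K`, `K ι(pE) K`, `K ι(p⁻¹E) K`;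
* **`heckeAlgebra.adjoin_padic_glInt_two_doubleCosetOperator_triple_eq_top`** — PROP. 4.6.5 for `F = ℚ_p`.
-- TODO(general form): Bump's statement for an arbitrary non-archimedean local field `F` (uniformizer `ϖ` in place
-- of `p`) is not reachable by this route (`GL_2(F) ≠ ι(G_p) K` when `e f > 1`); it wants PROP. 4.6.2 + (6.3) directly.

## References
* [Bump1997] D. Bump, *Automorphic Forms and Representations*, Cambridge Stud. Adv. Math. 55 (1997), §4.6 Prop. 4.6.5,
  Prop. 4.6.2, (6.3).
* [AndrianovZhuravlev1995] A. N. Andrianov, V. G. Zhuravlev, *Modular Forms and Hecke Operators*, Transl. Math.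
  Monogr. 145, AMS (1995), Ch. 3 §2.2 Thm. 2.17 (2); §2.1 (2.16)–(2.19); §1.3 Prop. 1.9.
-/

noncomputable section

open scoped MatrixGroups

open ValuativeRel Matrix

namespace Literature.NumberTheory.Automorphic

variable {p : ℕ}

/-- `pE_n = diag(p, …, p) ∈ G_p`. [cite: AndrianovZhuravlev1995, Ch. 3 §2.1 (2.16)–(2.19)] -/
theorem pScalar_mem_glnAway {n : ℕ} (hp : 0 < p) :
    (diagonalGL (Fin n) ℚ fun _ => Units.mk0 (p : ℚ) (Nat.cast_ne_zero.mpr hp.ne')) ∈ glnAway n p :=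
  ⟨⟨0, fun i j => by rw [pow_zero, one_smul]; exact (pScalar_mem_integral_glnAway (n := n) hp).1 i j⟩,
    (pScalar_mem_integral_glnAway (n := n) hp).2⟩

/-- `(pE_n)⁻¹ = diag(p⁻¹, …, p⁻¹) ∈ G_p`. [cite: AndrianovZhuravlev1995, Ch. 3 §2.1 (2.16)–(2.19)] -/
theorem pScalar_inv_mem_glnAway' {n : ℕ} (hp : 0 < p) :
    (diagonalGL (Fin n) ℚ fun _ => Units.mk0 (p : ℚ) (Nat.cast_ne_zero.mpr hp.ne'))⁻¹ ∈ glnAway n p :=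
  pScalar_inv_mem_glnAway (n := n) hp

/-- `diag(1, p) ∈ G_p²`. [cite: AndrianovZhuravlev1995, Ch. 3 §2.1 (2.16)–(2.19)] -/
theorem diagonalGL_one_prime_mem_glnAway' (hp : p.Prime) :
    (diagonalGL (Fin 2) ℚ fun i => Units.mk0 ((p : ℚ) ^ ((![0, 1] : Fin 2 → ℕ) i))
      (pow_ne_zero _ (Nat.cast_ne_zero.mpr hp.ne_zero))) ∈ glnAway 2 p :=
  heckeAlgebra.diagonalGL_one_prime_mem_glnAway hp

namespace heckeAlgebra

/-- Transport of generation along an algebra isomorphism. [folklore] -/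
private theorem adjoin_eq_top_of_algEquiv {k A B : Type*} [CommSemiring k] [Semiring A] [Semiring B] [Algebra k A]
    [Algebra k B] (e : A ≃ₐ[k] B) (S : Set A) (h : Algebra.adjoin k (e '' S) = ⊤) : Algebra.adjoin k S = ⊤ := by
  apply Subalgebra.map_injective (f := (e : A →ₐ[k] B)) e.injective
  rw [AlgHom.map_adjoin, Algebra.map_top, (AlgHom.range_eq_top _).mpr e.surjective]
  exact h

/-- **The Hecke ring `D(Λ², G_p²) ⊗ k` of the pair `(Λ, G_p)` is generated by the double cosets of `diag(1, p)`, `pE_2`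
and `(pE_2)⁻¹`** (THEOREM 2.17 (2) for the pair, through the embedding `D(Λ, G_p) ↪ H` of g40-#9:
`range_map_glnAway_two`). [cite: AndrianovZhuravlev1995, Ch. 3 §2.2 Thm. 2.17 (2); §2.1 (2.18)] -/
theorem adjoin_glnAway_two_doubleCosetOperator_triple_eq_top (k : Type*) [CommRing k] (hp : p.Prime) :
    haveI := isHeckeTriple_glnInt_subgroupOf_glnAway (n := 2) (p := p)
    Algebra.adjoin k ({doubleCosetOperator
          ((Matrix.GeneralLinearGroup.map (n := Fin 2) (Int.castRingHom ℚ)).range.subgroupOf (glnAway 2 p))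
          (⟨_, diagonalGL_one_prime_mem_glnAway' hp⟩ : glnAway 2 p),
        doubleCosetOperator
          ((Matrix.GeneralLinearGroup.map (n := Fin 2) (Int.castRingHom ℚ)).range.subgroupOf (glnAway 2 p))
          (⟨_, pScalar_mem_glnAway (n := 2) hp.pos⟩ : glnAway 2 p),
        doubleCosetOperator
          ((Matrix.GeneralLinearGroup.map (n := Fin 2) (Int.castRingHom ℚ)).range.subgroupOf (glnAway 2 p))
          (⟨_, pScalar_inv_mem_glnAway' (n := 2) hp.pos⟩ : glnAway 2 p)} :
        Set (heckeAlgebra k (glnAway 2 p)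
          ((Matrix.GeneralLinearGroup.map (n := Fin 2) (Int.castRingHom ℚ)).range.subgroupOf (glnAway 2 p)))) = ⊤ := by
  haveI := isHeckeTriple_glnInt_subgroupOf_glnAway (n := 2) (p := p)
  haveI := isHeckeTriple_glnInt_glnRat (Fin 2)
  set E := map (k := k) (glnAway 2 p).subtype
    ((Matrix.GeneralLinearGroup.map (n := Fin 2) (Int.castRingHom ℚ)).range.subgroupOf (glnAway 2 p))
    (Matrix.GeneralLinearGroup.map (n := Fin 2) (Int.castRingHom ℚ)).range rfl glnInt_le_range_subtype_glnAway with hE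
  apply Subalgebra.map_injective (f := E) (map_glnAway_injective (n := 2) (p := p) k)
  rw [AlgHom.map_adjoin, Algebra.map_top, hE, range_map_glnAway_two k hp]
  congr 1
  rw [Set.image_insert_eq, Set.image_insert_eq, Set.image_singleton, map_glnAway_doubleCosetOperator,
    map_glnAway_doubleCosetOperator, map_glnAway_doubleCosetOperator]
  simp only [doubleCosetOperator_diag_one_prime_eq_tOperator k hp]

/-- **The Hecke algebra `ℋ(GL_2(F), GL_2(𝒪_F); k)` is generated by `T(𝔭)`, `R(𝔭)` and `R(𝔭)⁻¹`** (Bump PROPOSITION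
4.6.5: «The spherical Hecke algebra `ℋ_K` is generated by `T(𝔭)`, `R(𝔭)`, and `R(𝔭)⁻¹`») — here `T(𝔭) = K ι(diag(1, p)) K`,
`R(𝔭) = K ι(pE_2) K`, `R(𝔭)⁻¹ = K ι(p⁻¹E_2) K` — for `F` as in `GLnPadicHeckeAlgebraComparison` (the prime `p` a
uniformizer, `ℤ ↠ 𝓀[F]`; model `ℚ_p`), over any commutative ring `k`, through the comparison with `D(Λ², G_p²) ⊗ k`.
-- TODO(general form): Bump states it for every non-archimedean local field `F` (with `ϖ` for `p`).
[cite: Bump1997, Prop. 4.6.5] [cite: AndrianovZhuravlev1995, Ch. 3 §2.2 Thm. 2.17 (2)] -/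
theorem adjoin_glInt_two_doubleCosetOperator_triple_eq_top {F : Type*} [Field F] [ValuativeRel F] [CharZero F]
    [IsDiscreteValuationRing 𝒪[F]] [Finite 𝓀[F]] (k : Type*) [CommRing k] (hϖ : IsUniformizingElement ((p : ℕ) : F))
    (hp : p.Prime) (hres : ∀ x : F, x ∈ 𝒪[F] → ∃ m : ℤ, valuation F (x - m) < 1) :
    haveI := isHeckeTriple_glInt_of_finite_residueField (F := F) 2
    Algebra.adjoin k ({doubleCosetOperator (glInt 2 F) (Matrix.GeneralLinearGroup.map (Rat.castHom F)
          (diagonalGL (Fin 2) ℚ fun i => Units.mk0 ((p : ℚ) ^ ((![0, 1] : Fin 2 → ℕ) i))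
            (pow_ne_zero _ (Nat.cast_ne_zero.mpr hp.ne_zero)))),
        doubleCosetOperator (glInt 2 F) (Matrix.GeneralLinearGroup.map (Rat.castHom F)
          (diagonalGL (Fin 2) ℚ fun _ => Units.mk0 (p : ℚ) (Nat.cast_ne_zero.mpr hp.pos.ne'))),
        doubleCosetOperator (glInt 2 F) (Matrix.GeneralLinearGroup.map (Rat.castHom F)
          (diagonalGL (Fin 2) ℚ fun _ => Units.mk0 (p : ℚ) (Nat.cast_ne_zero.mpr hp.pos.ne'))⁻¹)} :
        Set (heckeAlgebra k (GL (Fin 2) F) (glInt 2 F))) = ⊤ := by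
  haveI := isHeckeTriple_glInt_of_finite_residueField (F := F) 2
  haveI := isHeckeTriple_glnInt_subgroupOf_glnAway (n := 2) (p := p)
  obtain ⟨e, he⟩ := exists_algEquiv_heckeAlgebra_glInt_glnAway (n := 2) (p := p) k hϖ hp hres
  refine adjoin_eq_top_of_algEquiv e _ ?_
  rw [Set.image_insert_eq, Set.image_insert_eq, Set.image_singleton,
    he ⟨_, diagonalGL_one_prime_mem_glnAway' hp⟩, he ⟨_, pScalar_mem_glnAway (n := 2) hp.pos⟩,
    he ⟨_, pScalar_inv_mem_glnAway' (n := 2) hp.pos⟩]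
  exact adjoin_glnAway_two_doubleCosetOperator_triple_eq_top k hp


/-- **BUMP PROPOSITION 4.6.5 for `ℚ_p`: the spherical Hecke algebra `ℋ(GL_2(ℚ_p), GL_2(ℤ_p); k)` is generated by
`T(p) = K diag(1, p) K`, `R(p) = K pE_2 K` and `R(p)⁻¹ = K p⁻¹E_2 K`** (over any commutative ring `k`; `K = GL_2(ℤ_p) =
glInt 2 ℚ_[p]`, the matrices taken in the image of `GL_2(ℚ)`). [cite: Bump1997, Prop. 4.6.5]
[cite: AndrianovZhuravlev1995, Ch. 3 §2.2 Thm. 2.17 (2)] -/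
theorem adjoin_padic_glInt_two_doubleCosetOperator_triple_eq_top (p : ℕ) [Fact p.Prime] (k : Type*) [CommRing k] :
    haveI : IsNonarchimedeanLocalField ℚ_[p] :=
      Literature.NumberTheory.GaloisRepresentations.Padic.isNonarchimedeanLocalField_holds p
    haveI := isHeckeTriple_glInt_of_finite_residueField (F := ℚ_[p]) 2
    Algebra.adjoin k ({doubleCosetOperator (glInt 2 ℚ_[p]) (Matrix.GeneralLinearGroup.map (Rat.castHom ℚ_[p])
          (diagonalGL (Fin 2) ℚ fun i => Units.mk0 ((p : ℚ) ^ ((![0, 1] : Fin 2 → ℕ) i))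
            (pow_ne_zero _ (Nat.cast_ne_zero.mpr (Fact.out : p.Prime).ne_zero)))),
        doubleCosetOperator (glInt 2 ℚ_[p]) (Matrix.GeneralLinearGroup.map (Rat.castHom ℚ_[p])
          (diagonalGL (Fin 2) ℚ fun _ => Units.mk0 (p : ℚ) (Nat.cast_ne_zero.mpr (Fact.out : p.Prime).pos.ne'))),
        doubleCosetOperator (glInt 2 ℚ_[p]) (Matrix.GeneralLinearGroup.map (Rat.castHom ℚ_[p])
          (diagonalGL (Fin 2) ℚ fun _ => Units.mk0 (p : ℚ) (Nat.cast_ne_zero.mpr (Fact.out : p.Prime).pos.ne'))⁻¹)} :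
        Set (heckeAlgebra k (GL (Fin 2) ℚ_[p]) (glInt 2 ℚ_[p]))) = ⊤ := by
  haveI : IsNonarchimedeanLocalField ℚ_[p] :=
    Literature.NumberTheory.GaloisRepresentations.Padic.isNonarchimedeanLocalField_holds p
  haveI := isHeckeTriple_glInt_of_finite_residueField (F := ℚ_[p]) 2
  haveI := isHeckeTriple_glnInt_subgroupOf_glnAway (n := 2) (p := p)
  have hp : p.Prime := Fact.out
  obtain ⟨e, he⟩ := exists_algEquiv_heckeAlgebra_padic_glnAway p k 2
  refine adjoin_eq_top_of_algEquiv e _ ?_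
  rw [Set.image_insert_eq, Set.image_insert_eq, Set.image_singleton,
    he ⟨_, diagonalGL_one_prime_mem_glnAway' hp⟩, he ⟨_, pScalar_mem_glnAway (n := 2) hp.pos⟩,
    he ⟨_, pScalar_inv_mem_glnAway' (n := 2) hp.pos⟩]
  exact adjoin_glnAway_two_doubleCosetOperator_triple_eq_top k hp

end heckeAlgebra

end Literature.NumberTheory.Automorphic
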